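import Mathlib
import Summits.Ventures.HodgeRepro2.T6NDatum

/-!
# T6N1Datum — the N1 datum (TARGET-T6 §9.6 (1); owner t6-p1, second assignment)

The carrier of sub-step N1 of TIER5 (route/T5-ID-p2.md v10.1, Theorem ID): the IDENTIFICATION of the
quadruple period `I_{τ₁}(D_c, c) = ∫_S f^*(e_{1,τ₁} ∧ … ∧ e_{4,τ₁})` of the M2 datum `P : NDatum F`
(`NDatum.I`) with the Petersson pairing `⟨F_A, F_B⟩_{L²([G])}` of the two products of vertex theta lifts.
The datum carries ONLY objects and their normalisations — the surface carrier (complex conjugation on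
`H^*(S_c, ℂ)` and the Hodge piece `H^{1,0}(S_c)`, one per choice `c`), the dictionary «(2,0)-classes ↦
scalar automorphic functions» `sc` into the automorphic Hilbert space `LG = L²([G])` of the N3 datum
(TARGET-T6 §9.2(b): `LG := d3.LG`), and the volume constant `c_K = vol(K, dg_f)⁻¹ > 0` of ID-4(b′).
The products `F_A(c)`, `F_B(c)` of the vertex lifts are PARAMETERS (the lead passes the N3 datum's
`d3.A.F φ_a φ_b`, `d3.B.F φ_c φ_d` at the Schwartz data of the choice `c`), so that the Petersson pairing
`⟪F_B c, F_A c⟫_ℂ = ∫ F_A \overline{F_B}` is the same number on both sides without a compatibility field.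
The printed identifications (Theorem ID(i), (iii), (iv)) are stated over this datum in `T6N1Hyp.lean`
and consumed by name in `T6N1Main.lean`; nothing is asserted here. No display, no theorem.
§8(d): uses an L-value-free non-vanishing device: NO.
-/

namespace Summit.Ventures.HodgeRepro2.T6

open scoped InnerProductSpace

variable {K : Type*} [Field K] [NumberField K]

/-- The N1 datum over the M2 period datum `P` (TIER5 Theorem ID, route/T5-ID-p2.md): the surface
carrier (conjugation and `H^{1,0}` on `H^*(S_c, ℂ)` for every choice `c`), the Borel–Wallach /
Matsushima dictionary `sc` into the automorphic space `LG`, and the volume constant `c_K`. `FA c`, `FB c`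
are the scalar automorphic functions `F_A = η_a η_b`, `F_B = η_{c̄} η_{d̄}` of the choice `c` (ID-4(c),
dictionary row D5) — parameters, supplied from the N3 datum. -/
structure N1Datum (F : FaceSetting K) (P : NDatum F) (LG : Type) [NormedAddCommGroup LG]
    [InnerProductSpace ℂ LG] (FA FB : P.Choice → LG) where
  /-- Complex conjugation on `H^*(S_c, ℂ) = H^*(S_c, ℚ) ⊗_ℚ ℂ` (through the coefficients): a ring
  endomorphism of the shadow `H^*(S_c, ℂ)`. -/
  conj : ∀ c : P.Choice, (P.shadow c).HS →+* (P.shadow c).HS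
  /-- Conjugation is ℂ-antilinear. -/
  conj_smul : ∀ (c : P.Choice) (z : ℂ) (x : (P.shadow c).HS), conj c (z • x) = (starRingEnd ℂ z) • conj c x
  /-- Conjugation is an involution. -/
  conj_conj : ∀ (c : P.Choice) (x : (P.shadow c).HS), conj c (conj c x) = x
  /-- The Hodge piece `H^{1,0}(S_c) ⊂ H^1(S_c, ℂ)` (holomorphic 1-forms; `H^{0,1} = \overline{H^{1,0}}`). -/
  H10 : ∀ c : P.Choice, Submodule ℂ (P.shadow c).HS
  /-- The forms ↔ functions dictionary of ID-4(a)–(b): a `(2,0)`-class (a holomorphic 2-form on `S_c`,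
  harmonic) `ω ↦ F_ω^{sc}`, its scalar automorphic function on `[G]` (right `K`-invariant, `K₁`-type
  `∧²𝔭⁺`) for the unit basis vector `ϵ` of `∧²(𝔭⁺)^*` (Borel–Wallach I.1.6 + VII.2.5 + II.4 (3)). Only the
  values on `H^{2,0}(S_c) = H^{1,0} · H^{1,0}` are constrained by the displays. -/
  sc : ∀ c : P.Choice, (P.shadow c).HS →ₗ[ℂ] LG
  /-- The volume constant `c_K = vol(K, dg_f)⁻¹` of ID-4(b′) (independent of the choice and of the
  forms; `= 1` when `dg_f` is normalised by `vol(K) = 1`). -/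
  cK : ℝ
  /-- `c_K > 0` (TIER5 ID-4(b′); p2's `T5IntegralBookkeeping.inv_measure_pos`). -/
  cK_pos : 0 < cK

namespace N1Datum

variable {F : FaceSetting K} {P : NDatum F} {LG : Type} [NormedAddCommGroup LG] [InnerProductSpace ℂ LG]
  {FA FB : P.Choice → LG} (d : N1Datum F P LG FA FB)

/-- `H^{2,0}(S_c) = H^{1,0}(S_c) · H^{1,0}(S_c)` (the holomorphic 2-forms). -/
def H20 (c : P.Choice) : Submodule ℂ (P.shadow c).HS := d.H10 c * d.H10 c

/-- `H^{0,1}(S_c) = \overline{H^{1,0}(S_c)}`: the ℂ-span of the conjugates of `H^{1,0}` (already a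
ℂ-subspace, `conj` being antilinear). -/
def H01 (c : P.Choice) : Submodule ℂ (P.shadow c).HS := Submodule.span ℂ (d.conj c '' (d.H10 c))

/-- The Petersson pairing of the choice `c`: `⟨F_A, F_B⟩_{L²([G])} = ∫_{[G]} F_A \overline{F_B} dg =
⟪F_B, F_A⟫_ℂ` in Mathlib's convention (conjugate-linear in the first slot); TARGET-T6 §9.2(b) `pairing`. -/
noncomputable def pairing (_d : N1Datum F P LG FA FB) (c : P.Choice) : ℂ := ⟪FB c, FA c⟫_ℂ

end N1Datum

end Summit.Ventures.HodgeRepro2.T6
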